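import Summits.ValiantsHypothesis.ValiantsHypothesis.Theorems.BarrierLeverTropicalDetCertificateSuffices
import Literature.Computability.AlgebraicComplexity.NarayananElusiveProofs

/-!
# Route BarrierLever — conjecture CT (`TransversalResultantKernelNonsingular`, stmt-ValiantsHypothesis-19179):
# the FREE-BLOCK relaxation is a theorem (every layout), by the strict rearrangement inequality

Helper file (`--supports stmt-ValiantsHypothesis-19179`; cell valiant-natproofs, rung V4, 𝒟-side door (c);
prover seat val-np-p4 gen 8, memo `HOME/val-np-p4/MEMO-p4g8.md` §1/§6). Closes NO item.

**Setting.** The CT layout matrix of an injective layout `u, w : Fin r → Finset (Fin h)` is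
`M[i,j] = ∏_{a,c} N_{ac}[a ∈ u i, c ∈ w j]` with the CONSTRAINED 2×2 blocks `N_{ac}[ε,δ] = p(ℓ_a^ε) − q(ℓ_c^δ)`
(differences of 4h numbers).  Normalising each block by row/column scalings leaves the kernel
`G_q[U,W] = ∏_{a ∈ U} ∏_{c ∈ W} q_{ac}` with `q_{ac}` = the CROSS-RATIO of `(p(ℓ_a^0), p(ℓ_a^1); q(ℓ_c^0), q(ℓ_c^1))`;
so CT says that the (4h−3)-dimensional cross-ratio variety avoids the hypersurfaces `det G_q[R,C] = 0`.

**Theorem (`freeKernel_layout_det_ne_zero`).** With FREE parameters `q : Fin h → Fin h → ℂ` every layout minor is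
nonzero: for all `h r` and injective `u w : Fin r → Finset (Fin h)` there is `q` with
`det (∏_{a ∈ u i} ∏_{c ∈ w j} q a c)_{i,j} ≠ 0`.  *Proof.* Take `q a c = z^{2^a · 2^c}`; then the entry is
`z^{α_i β_j}` with `α_i = Σ_{a∈u i} 2^a`, `β_j = Σ_{c∈w j} 2^c` injective in `i`, `j` (binary expansions,
tree lemma `Literature.Computability.AlgebraicComplexity.doublingExp_injective`).  Over `ℂ[X]` the Leibniz term of `σ` has degree `Σ_j α_{σ j} β_j`, which by the STRICT
rearrangement inequality (`Monovary.sum_comp_perm_mul_lt_sum_mul_iff`, uniqueness via `Tuple.unique_monotone`) is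
maximised by a UNIQUE permutation (match the k-th smallest `α` with the k-th smallest `β`); hence the determinant is a
nonzero polynomial (tree lemma `TropicalDet.det_ne_zero_of_unique_maxDegree`) and some `z ∈ ℂ` is not a root.
`freeBlocks_layout_det_ne_zero` restates it with free 2×2 blocks `N a c : Bool → Bool → ℂ` in the shape of item 19179.

WHAT THIS IS NOT: not CT — the blocks of CT are constrained (their cross-ratios form a (4h−3)-parameter family, the
free kernel has h² parameters); this only isolates the cross-ratio constraint as the whole content of CT (and shows
the classical fact that `[e^{s_i t_j}]`-type kernels are totally nonsingular in its simplest algebraic dress).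
Nothing here bears on crux stmt-ValiantsHypothesis-14610 or on VP versus VNP.
-/

-- layout Summits/ValiantsHypothesis/ValiantsHypothesis forces the duplicated namespace component
set_option linter.dupNamespace false

open Finset Polynomial

namespace Summit.ValiantsHypothesis.ValiantsHypothesis.Theorems.BarrierLever.ResultantKernel.FreeBlocks

/-! ## 1. Strict rearrangement: a unique optimal assignment for injective weights -/

/-- For injective `α β : Fin r → ℕ` the assignment problem `σ ↦ Σ_j α (σ j) · β j` has a UNIQUE maximiser
(the permutation matching the sorted orders); every other permutation is strictly worse. -/
theorem exists_unique_max_assignment {r : ℕ} (α β : Fin r → ℕ) (hα : Function.Injective α)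
    (hβ : Function.Injective β) :
    ∃ σ₀ : Equiv.Perm (Fin r), ∀ σ : Equiv.Perm (Fin r), σ ≠ σ₀ →
      ∑ j, α (σ j) * β j < ∑ j, α (σ₀ j) * β j := by
  classical
  set eα := Tuple.sort α with heα
  set eβ := Tuple.sort β with heβ
  have hmα : Monotone (α ∘ eα) := Tuple.monotone_sort α
  have hmβ : Monotone (β ∘ eβ) := Tuple.monotone_sort β
  -- σ₀ sends the column of β-rank k to the row of α-rank k
  refine ⟨eβ.symm.trans eα, fun σ hσ => ?_⟩
  set σ₀ : Equiv.Perm (Fin r) := eβ.symm.trans eα with hσ₀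
  -- β-order comparison transported through the sorting permutation
  have hlt_of : ∀ i j : Fin r, β i < β j → eβ.symm i < eβ.symm j := by
    intro i j hij
    by_contra hle
    push Not at hle
    have := hmβ hle
    simp only [Function.comp_apply, Equiv.apply_symm_apply] at this
    exact absurd hij (not_lt.mpr this)
  have hmono₀ : Monovary (α ∘ σ₀) β := by
    intro i j hij
    have hk := hlt_of i j hij
    have := hmα hk.le
    simpa [hσ₀] using this
  -- uniqueness: a monovarying assignment coincides with σ₀
  have huniq : ∀ τ : Equiv.Perm (Fin r), Monovary (α ∘ τ) β → τ = σ₀ := by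
    intro τ hτ
    have hmon : ∀ ρ : Equiv.Perm (Fin r), Monovary (α ∘ ρ) β → Monotone (α ∘ ⇑(eβ.trans ρ)) := by
      intro ρ hρ k l hkl
      rcases hkl.lt_or_eq with hlt | heq
      · have hβle : β (eβ k) ≤ β (eβ l) := hmβ hlt.le
        rcases hβle.lt_or_eq with hβlt | hβeq
        · simpa using hρ hβlt
        · have : k = l := eβ.injective (hβ hβeq)
          simp [this]
      · simp [heq]
    have h1 := hmon τ hτ
    have h2 := hmon σ₀ hmono₀
    have heq : α ∘ ⇑(eβ.trans τ) = α ∘ ⇑(eβ.trans σ₀) := Tuple.unique_monotone h1 h2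
    have hperm : eβ.trans τ = eβ.trans σ₀ := by
      ext k
      have := congrFun heq k
      simp only [Function.comp_apply] at this
      exact congrArg Fin.val (hα this)
    have : τ = σ₀ := by
      have := congrArg (fun e => eβ.symm.trans e) hperm
      simpa [← Equiv.trans_assoc] using this
    exact this
  -- strict rearrangement inequality for f := α ∘ σ₀, g := β, permutation σ₀⁻¹ ∘ σ
  have hcomp : (α ∘ ⇑σ₀) ∘ ⇑(σ.trans σ₀.symm) = α ∘ ⇑σ := by
    ext x; simp
  have hstrict := (Monovary.sum_comp_perm_mul_lt_sum_mul_iff (σ := σ.trans σ₀.symm) hmono₀).mpr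
    (by
      rw [hcomp]
      intro hm
      exact hσ (huniq σ hm))
  have hsum : ∑ j, (α ∘ ⇑σ₀) ((σ.trans σ₀.symm) j) * β j = ∑ j, α (σ j) * β j := by
    refine Finset.sum_congr rfl fun j _ => ?_
    simp
  rw [hsum] at hstrict
  simpa [Function.comp_apply] using hstrict

/-! ## 2. The monomial matrix `X^{α_i β_j}` has nonzero determinant -/

/-- For injective exponent weights the matrix `(X^{α_i β_j})_{i,j}` over `ℂ[X]` has nonzero determinant:
its Leibniz expansion has a unique term of maximal degree. -/
theorem det_X_pow_mul_ne_zero {r : ℕ} (α β : Fin r → ℕ) (hα : Function.Injective α)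
    (hβ : Function.Injective β) :
    (Matrix.of fun i j : Fin r => (X : ℂ[X]) ^ (α i * β j)).det ≠ 0 := by
  obtain ⟨σ₀, hσ₀⟩ := exists_unique_max_assignment α β hα hβ
  refine TropicalDet.det_ne_zero_of_unique_maxDegree _ σ₀ (fun j => ?_) (fun σ hσ => Or.inr ?_)
  · simp
  · simpa [Matrix.of_apply, natDegree_X_pow] using hσ₀ σ hσ

/-! ## 3. The free kernel and the free-block form of CT -/

/-- **The free kernel is totally nonsingular on layouts.** For every injective layout there are free
parameters `q : Fin h → Fin h → ℂ` with `det (∏_{a ∈ u i} ∏_{c ∈ w j} q a c)_{i,j} ≠ 0`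
(explicitly `q a c = z ^ (2^a · 2^c)` for a suitable `z`). -/
theorem freeKernel_layout_det_ne_zero (h r : ℕ) (u w : Fin r → Finset (Fin h))
    (hu : Function.Injective u) (hw : Function.Injective w) :
    ∃ q : Fin h → Fin h → ℂ,
      (Matrix.of fun i j : Fin r => ∏ a ∈ u i, ∏ c ∈ w j, q a c).det ≠ 0 := by
  classical
  set α : Fin r → ℕ := fun i => ∑ a ∈ u i, 2 ^ (a : ℕ) with hαdef
  set β : Fin r → ℕ := fun j => ∑ c ∈ w j, 2 ^ (c : ℕ) with hβdef
  have hα : Function.Injective α := fun i i' e =>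
    hu (Literature.Computability.AlgebraicComplexity.doublingExp_injective h e)
  have hβ : Function.Injective β := fun j j' e =>
    hw (Literature.Computability.AlgebraicComplexity.doublingExp_injective h e)
  have hdet := det_X_pow_mul_ne_zero α β hα hβ
  obtain ⟨z, hz⟩ := ResultantKernel.exists_eval_ne_zero_of_ne_zero hdet
  refine ⟨fun a c => z ^ (2 ^ (a : ℕ) * 2 ^ (c : ℕ)), ?_⟩
  -- evaluation at `z` commutes with the determinant and turns `X^{α_i β_j}` into the product entry
  have hmap : (Polynomial.evalRingHom z).mapMatrix
      (Matrix.of fun i j : Fin r => (X : ℂ[X]) ^ (α i * β j)) =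
      Matrix.of fun i j : Fin r => ∏ a ∈ u i, ∏ c ∈ w j, z ^ (2 ^ (a : ℕ) * 2 ^ (c : ℕ)) := by
    ext i j
    simp only [RingHom.mapMatrix_apply, Matrix.map_apply, Matrix.of_apply, Polynomial.coe_evalRingHom,
      eval_pow, eval_X]
    rw [hαdef, hβdef]
    simp only
    rw [Finset.sum_mul_sum, ← Finset.prod_pow_eq_pow_sum]
    refine Finset.prod_congr rfl fun a _ => ?_
    rw [← Finset.prod_pow_eq_pow_sum]
  have := RingHom.map_det (Polynomial.evalRingHom z) (Matrix.of fun i j : Fin r => (X : ℂ[X]) ^ (α i * β j))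
  rw [hmap] at this
  rw [← this]
  simpa using hz

/-- **Free-block form of CT.** In the shape of item 19179 — entries `∏_a ∏_c N a c [a ∈ u i] [c ∈ w j]` — but with
FREE 2×2 blocks `N a c : Bool → Bool → ℂ` instead of the constrained differences `p(ℓ_a^ε) − q(ℓ_c^δ)`, every
injective layout has a nonsingular layout matrix. -/
theorem freeBlocks_layout_det_ne_zero (h r : ℕ) (u w : Fin r → Finset (Fin h))
    (hu : Function.Injective u) (hw : Function.Injective w) :
    ∃ N : Fin h → Fin h → Bool → Bool → ℂ,
      (Matrix.of fun i j : Fin r => ∏ a : Fin h, ∏ c : Fin h,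
        N a c (decide (a ∈ u i)) (decide (c ∈ w j))).det ≠ 0 := by
  classical
  obtain ⟨q, hq⟩ := freeKernel_layout_det_ne_zero h r u w hu hw
  refine ⟨fun a c b b' => if b && b' then q a c else 1, ?_⟩
  have hent : ∀ i j : Fin r, (∏ a : Fin h, ∏ c : Fin h,
      (if (decide (a ∈ u i) && decide (c ∈ w j)) then q a c else 1)) = ∏ a ∈ u i, ∏ c ∈ w j, q a c := by
    intro i j
    rw [← Finset.prod_filter_mul_prod_filter_not Finset.univ (fun a => a ∈ u i)]
    have h2 : ∏ a ∈ Finset.univ.filter (fun a => ¬ a ∈ u i), ∏ c : Fin h,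
        (if (decide (a ∈ u i) && decide (c ∈ w j)) then q a c else 1) = 1 := by
      refine Finset.prod_eq_one fun a ha => ?_
      simp only [Finset.mem_filter, Finset.mem_univ, true_and] at ha
      simp [ha]
    rw [h2, mul_one]
    have h1 : Finset.univ.filter (fun a => a ∈ u i) = u i := by ext a; simp
    rw [h1]
    refine Finset.prod_congr rfl fun a ha => ?_
    rw [← Finset.prod_filter_mul_prod_filter_not Finset.univ (fun c => c ∈ w j)]
    have h3 : ∏ c ∈ Finset.univ.filter (fun c => ¬ c ∈ w j),
        (if (decide (a ∈ u i) && decide (c ∈ w j)) then q a c else 1) = 1 := by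
      refine Finset.prod_eq_one fun c hc => ?_
      simp only [Finset.mem_filter, Finset.mem_univ, true_and] at hc
      simp [hc]
    rw [h3, mul_one]
    have h4 : Finset.univ.filter (fun c => c ∈ w j) = w j := by ext c; simp
    rw [h4]
    refine Finset.prod_congr rfl fun c hc => ?_
    simp [ha, hc]
  have hM : (Matrix.of fun i j : Fin r => ∏ a : Fin h, ∏ c : Fin h,
      (if (decide (a ∈ u i) && decide (c ∈ w j)) then q a c else 1)) =
      Matrix.of fun i j : Fin r => ∏ a ∈ u i, ∏ c ∈ w j, q a c := by
    ext i j; simp only [Matrix.of_apply]; exact hent i j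
  show (Matrix.of fun i j : Fin r => ∏ a : Fin h, ∏ c : Fin h,
      (if (decide (a ∈ u i) && decide (c ∈ w j)) then q a c else 1)).det ≠ 0
  rw [hM]
  exact hq

end Summit.ValiantsHypothesis.ValiantsHypothesis.Theorems.BarrierLever.ResultantKernel.FreeBlocks
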